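import Mathlib
import HarnessLib

/-!
# Markman 2025 — LEMMA 6.3.1 («`ν ∘ (id ⊗ τ) = φ̃`»: Orlov's equivalence induces Chevalley's isomorphism
# `S ⊗ S ≅ ∧^*V`): the SIGN BOOKKEEPING of its proof — `ε_{K,K^c} = (−1)^{Σ(K) − k(k+1)/2}` as an inversion count,
# `ε_{K^c,K} = (−1)^k ε_{K,K^c}`, `σ_K = (−1)^{k(k+3)/2}` (footnote 13), and the exponents of (6.3.1) and of the
# `φ̃`-side display — AS PRINTED (v2 p. 36 L43 – p. 37 L83), kernel-checked

E. Markman: [M] *Cycles on abelian 2n-folds of Weil type from secant sheaves on abelian n-folds*,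
arXiv:2502.03415 **v2** (2025-06-08), bib `Markman2025SecantWeil` — UNREFEREED PREPRINT. «p. N L m» = PyMuPDF line `m`
of page `N` of the public v2 PDF (sha256/16 `8155aa33870069b8`), read at seat lit-w-markman g22 (pub-hsemireg LIT-W,
2026-08-25; §6.3 from the numbered text layer, p. 36 L25–78 and p. 37 re-read BY EYE on the renders
`r_mar25v2_p36_lemma631.png`, `r_mar25v2_p37_lemma631_proof.png` in `HOME/lit/Markman-renders-litw-markman-g22/`;
sheet `LOCATOR-SHEET-MARKMAN.md` §69). The text layer prints the index sum as «P(K)»; BY EYE the symbol is «Σ(K)»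
(`Σ(K) := Σ_{t=1}^k i_t`), used below. Lemma 6.3.1 identifies the cohomological action `ν` of
`(Ψ_{𝒫⁻¹}[n] ⊗ 1) ∘ μ^*` with the Chevalley isomorphism `φ̃` of (2.3.2); it feeds Lemma 6.1.1 (`ϕ = (ϕ_𝒫 ⊗ ψ_{𝒫⁻¹}[n]) ∘
φ̃ ∘ (id ⊗ τ)`) and Lemma 6.3.2, i.e. the grading ∕ filtration statements behind (6.1.4)–(6.1.7). Companion files of
this seat: `CorrespondenceSpinEquivariance.lean` (§5.2), `OrlovEquivarianceDimensionCounts.lean` (Prop. 6.1.2),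
`SecantSquaredInvariantTwist.lean` (Lemma 6.2.3 ∕ 6.2.5).

## What is printed (verbatim; displays linearised; `Σ(K)` by eye for the text layer's `P(K)`)

* p. 36 L25–42: «6.3. Orlov's equivalence induces Chevalley's isomorphism `S ⊗ S ≅ ∧^*V`. Let `β := {e₁, …, e_{2n}}` be
  a basis of `H¹(X, ℤ)` and let `{f₁, …, f_{2n}}` be the dual basis of `H¹(X̂, ℤ)`. Define `μ : X × X → X × X` by
  `μ(x, y) = (x + y, y)`. Then `μ^*(π₁^*(e_i)) = π₁^*(e_i) + π₂^*(e_i)`, `μ^*(π₂^*(e_i)) = π₂^*(e_i)`. … LEMMA 6.3.1. The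
  equality `ν ∘ (id ⊗ τ) = φ̃` holds.»
* PROOF, p. 36 L43–55: «Given a subset `K := {i₁, i₂, …, i_k}` of `[1, 2n] := {1, 2, …, 2n}`, ordered by the induced
  ordering of `[1, 2n]` so that `i_t < i_{t+1}`, set `e_K := e_{i₁} ∧ e_{i₂} ∧ ⋯ ∧ e_{i_k}` and `f_K := f_{i₁} ∧ f_{i₂} ∧ ⋯
  ∧ f_{i_k}`. Let `L = {j₁, …, j_ℓ}` be another subset, with `j_t < j_{t+1}`, and define `e_L` similarly. Given a subset
  `I ⊂ K`, we denote by `I′` its complement in `K` and by `I^c` its complement in `[1, 2n]`. Define `ε_{K,L} ∈ {−1, 0, 1}`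
  by the equality `e_K ∧ e_L = ε_{K,L}e_{K∪L}`. So `ε_{K,L} = 0`, if `K ∩ L ≠ ∅`. Note that
  `ε_{K,K^c} = (−1)^{Σ(K) − k(k+1)/2}`, where `Σ(K) := Σ_{t=1}^k i_t`. Furthermore, `ε_{K^c,K} = (−1)^k ε_{K,K^c} =
  (−1)^{Σ(K) − k(k−1)/2}`. We have `e_K ∧ ε_{K,K^c}e_{K^c} = (ε_{K,K^c})²e_{K∪K^c} = e₁ ∧ ⋯ ∧ e_{2n}`. So Poincaré duality
  `PD_X` sends `e_K` to `∫_X e_K ∧ (•) = ε_{K,K^c}f_{K^c}`.»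
* p. 37 L3–5 and footnote 13 (L75–83): «The cohomological action of the functor `Ψ_{𝒫⁻¹}[n] : D^b(X) → D^b(X̂)` is given
  by `Ψ_{𝒫⁻¹}[n](e_K) = σ_K PD(e_K) = σ_K ε_{K,K^c}f_{K^c}`, where¹³ `σ_K = (−1)^{k(k+3)/2}`.» — «¹³`ϕ_𝒫 : H^k(X̂, ℤ) →
  H^{2n−k}(X, ℤ)` is equal to `(−1)^{k(k+1)/2+n}PD_k` … [H2, Lemma 9.23]. Furthermore, the composition
  `H^k(X̂, ℤ) →^{ϕ_𝒫} H^{2n−k}(X, ℤ) →^{ϕ_𝒫} H^k(X̂, ℤ)` is `(−1)^{k+n}` [H2, Cor. 9.24]. Now, `Ψ_{𝒫⁻¹}[n]` is the inverse of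
  `Φ_𝒫` and so the the cohomological action of `Ψ_{𝒫⁻¹}[n]` restricts to `H^k(X, ℤ)` as
  `(−1)^{k+n}ϕ_𝒫 = (−1)^{k(k+3)/2}PD_k`.»
* (6.3.1), p. 37 L15–34: «Interchanging `I` and `I′` … `ν(π₁^*e_K ∧ π₂^*e_L) = Σ_{I⊂K} ε_{I′,I}ε_{I,L}σ_{I′}ε_{I′,(I′)^c}
  π_X̂^*f_{(I′)^c} ∧ π_X^*(e_{I∪L}) = Σ_{I⊂K} ε_{I′,I}ε_{I,L}(−1)^{Σ(I′)−|I′|}π_X̂^*f_{(I′)^c} ∧ π_X^*(e_{I∪L})`.»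
* p. 37 L45–67 (the `φ̃` side): «`φ̃(e_K ⊗ e_L) = … = Σ_{I⊂K} ε_{I,I′}e_I ∧ δ_{I′}(f₁ ∧ ⋯ ∧ f_{2n}) ∧ (−1)^{ℓ(ℓ−1)/2}e_L =
  Σ_{I⊂K} ε_{I,I′}(−1)^{ℓ(ℓ−1)/2}(−1)^{|I|(2n−|I′|)}δ_{I′}(f₁ ∧ ⋯ ∧ f_{2n}) ∧ e_I ∧ e_L = Σ_{I⊂K} ε_{I,I′}(−1)^{ℓ(ℓ−1)/2}
  (−1)^{|I||I′|}(−1)^{Σ(I′)−|I′|}ε_{I,L}f_{(I′)^c} ∧ e_{I∪L} = Σ_{I⊂K} ε_{I′,I}(−1)^{ℓ(ℓ−1)/2}(−1)^{Σ(I′)−|I′|}ε_{I,L}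
  f_{(I′)^c} ∧ e_{I∪L}`, where in the fourth equality we used the equality `δ_{I′}(f₁ ∧ ⋯ ∧ f_{2n}) =
  (−1)^{Σ(I′)−|I′|}f_{(I′)^c}`. Comparing with (6.3.1) we get (6.3.2) `ν(π₁^*(e_K) ∧ π₂^*τ(e_L)) = φ̃(e_K ⊗ e_L)`.»
  (`τ(e_L) = (−1)^{ℓ(ℓ−1)/2}e_L`, (1.2.3).)

## What this file proves (0 `def`, 0 named fact, 0 sorry; parity ∕ inversion arithmetic only)

Signs are integers `(−1)^m`; a subset `K ⊂ [1, 2n]` is a `Finset ℕ` of positive integers, `Σ(K) = Σ_{a∈K} a`, `k = #K`.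
§A — the SHUFFLE EXPONENT: moving `e_K` past `e_{K^c}` into increasing order costs one transposition per inversion
`(a ∈ K, b ∉ K, b < a)`; their number is `Σ_{a∈K} #([1, a) ∖ K)`, and `inversions_add_triangle` proves
`Σ_{a∈K} #([1, a) ∖ K) + k(k+1)/2 = Σ(K)` (induction on the maximum of `K`), i.e. the printed exponent
«`Σ(K) − k(k+1)/2`» IS the inversion count (`inversions_eq_printed`; that `ε_{K,K^c}` is `(−1)^{inversions}` is the
definition of the wedge sign, BY VALUE). §B — «`ε_{K^c,K} = (−1)^k ε_{K,K^c} = (−1)^{Σ(K) − k(k−1)/2}`»: the swap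
`e_{K^c} ∧ e_K = (−1)^{k(2n−k)}e_K ∧ e_{K^c}` has `(−1)^{k(2n−k)} = (−1)^k` (`swap_sign_compl`), and the two printed
exponents differ by `k` (`exponent_Kc_K`); «`(ε_{K,K^c})² = 1`» (`sign_sq`). §C — footnote 13 ∕ `σ_K`:
`k(k+3)/2 = k(k+1)/2 + k` (`sigma_exponent`) and «`(−1)^{k+n}(−1)^{k(k+1)/2+n} = (−1)^{k(k+3)/2}`» (`footnote13`).
§D — (6.3.1): «`σ_{I′}ε_{I′,(I′)^c} = (−1)^{Σ(I′)−|I′|}`» as `(−1)^{k(k+3)/2}(−1)^{Σ − k(k+1)/2} = (−1)^{Σ − k}`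
(`eq631_exponent`, `k(k+1)/2 ≤ Σ` supplied by §A). §E — the `φ̃` side: «`(−1)^{|I|(2n−|I′|)} = (−1)^{|I||I′|}`»
(`sign_move_past`), «`ε_{I,I′}(−1)^{|I||I′|} = ε_{I′,I}`» given the graded-commutativity relation between the two
signs (`epsilon_swap`), and the contraction exponent «`δ_{I′}(f₁ ∧ ⋯ ∧ f_{2n}) = (−1)^{Σ(I′)−|I′|}f_{(I′)^c}`» as
`Σ_{a∈I′}(a − 1) = Σ(I′) − |I′|` (`contraction_exponent`: contracting `f_a` out of `f₁ ∧ ⋯` in decreasing order of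
`a ∈ I′` passes `a − 1` factors each; the contraction rule itself BY VALUE); finally `compare_632`: the (6.3.1)
coefficient times `τ`'s sign `(−1)^{ℓ(ℓ−1)/2}` equals the last `φ̃` coefficient, term by term («Comparing with (6.3.1)
we get (6.3.2)»). BY VALUE ∕ NOT modelled: the exterior algebra, `μ^*`, `PD`, `Ψ_{𝒫⁻¹}[n]`, [H2, Lemma 9.23 ∕ Cor.
9.24], the Clifford-algebra description of `φ̃` (§2.3), the binomial expansions «`Σ_{I⊂K} ε_{I,I′} …`» themselves.
Print notes (typographic, ×1): «satisfing», «identifiation», «the the» (p. 37). Nothing here says any object is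
semiregular or that HC ∕ HC_CM ∕ HC_AV is proved.
-/

namespace Literature.AlgebraicGeometry.Markman2025.Lemma631

open Finset

/-! ### §A — «`ε_{K,K^c} = (−1)^{Σ(K) − k(k+1)/2}`»: the exponent is the number of inversions -/

/-- THE INVERSION COUNT. For a finite set `K` of positive integers (`K = {i₁ < ⋯ < i_k} ⊂ [1, 2n]`), the number of
pairs `(a, b)` with `a ∈ K`, `b ∉ K`, `1 ≤ b < a` — the transpositions needed to bring `e_K ∧ e_{K^c}` to
`e₁ ∧ ⋯ ∧ e_{2n}` — satisfies `#inversions + k(k+1)/2 = Σ(K)`; this is the printed exponent «`Σ(K) − k(k+1)/2`»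
(each `i_t` sees `(i_t − 1) − (t − 1) = i_t − t` smaller non-members). Induction on `max K`.
[cite: Markman2025SecantWeil, proof of Lemma 6.3.1, p. 36 L47–50] -/
theorem inversions_add_triangle (K : Finset ℕ) (hK : ∀ a ∈ K, 1 ≤ a) :
    (∑ a ∈ K, ((Ico 1 a) \ K).card) + K.card * (K.card + 1) / 2 = ∑ a ∈ K, a := by
  induction K using Finset.induction_on_max with
  | empty => simp
  | insert a s hlt ih =>
    have ha : a ∉ s := fun h => lt_irrefl a (hlt a h)
    have hs1 : ∀ x ∈ s, 1 ≤ x := fun x hx => hK x (mem_insert_of_mem hx)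
    have ha1 : 1 ≤ a := hK a (mem_insert_self a s)
    -- the old summands are unchanged: `a ∉ [1, x)` for `x ∈ s` (as `x < a`)
    have hold : ∀ x ∈ s, ((Ico 1 x) \ insert a s).card = ((Ico 1 x) \ s).card := by
      intro x hx
      rw [sdiff_insert, erase_eq_of_notMem]
      intro h
      exact absurd (mem_Ico.mp (mem_sdiff.mp h).1).2 (not_lt.mpr (le_of_lt (hlt x hx)))
    -- the new summand: `[1, a) ∖ (insert a s) = [1, a) ∖ s` has `(a − 1) − #s` elements, since `s ⊆ [1, a)`
    have hnew : (Ico 1 a) \ insert a s = (Ico 1 a) \ s := by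
      rw [sdiff_insert, erase_eq_of_notMem]
      intro h
      exact absurd (mem_Ico.mp (mem_sdiff.mp h).1).2 (lt_irrefl a)
    have hsub : s ⊆ Ico 1 a := fun x hx => mem_Ico.mpr ⟨hs1 x hx, hlt x hx⟩
    have hcard_new : ((Ico 1 a) \ s).card = (a - 1) - s.card := by
      rw [card_sdiff_of_subset hsub, Nat.card_Ico]
    have hsc : s.card ≤ a - 1 := by
      have := card_le_card hsub; rwa [Nat.card_Ico] at this
    rw [sum_insert ha, sum_insert ha, card_insert_of_notMem ha, hnew, hcard_new,
      sum_congr rfl hold]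
    have ih' := ih hs1
    -- arithmetic: `(a − 1 − #s) + old + (#s+1)(#s+2)/2 = a + Σ(s)` from `old + #s(#s+1)/2 = Σ(s)`
    have htri : (s.card + 1) * (s.card + 1 + 1) / 2 = s.card * (s.card + 1) / 2 + (s.card + 1) := by
      have : (s.card + 1) * (s.card + 1 + 1) = s.card * (s.card + 1) + 2 * (s.card + 1) := by ring
      rw [this, Nat.add_mul_div_left _ _ (by norm_num)]
    omega

/-- Hence the printed exponent: `#inversions = Σ(K) − k(k+1)/2` (truncated subtraction is exact here, and
`k(k+1)/2 ≤ Σ(K)`). [cite: Markman2025SecantWeil, proof of Lemma 6.3.1, p. 36 L47–50] -/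
theorem inversions_eq_printed (K : Finset ℕ) (hK : ∀ a ∈ K, 1 ≤ a) :
    (∑ a ∈ K, ((Ico 1 a) \ K).card) = (∑ a ∈ K, a) - K.card * (K.card + 1) / 2 ∧
      K.card * (K.card + 1) / 2 ≤ ∑ a ∈ K, a := by
  have h := inversions_add_triangle K hK
  omega

/-! ### §B — «`ε_{K^c,K} = (−1)^k ε_{K,K^c} = (−1)^{Σ(K) − k(k−1)/2}`» and «`(ε_{K,K^c})² = 1`» -/

/-- Swapping the two blocks: `e_{K^c} ∧ e_K = (−1)^{k(2n−k)} e_K ∧ e_{K^c}` (graded commutativity, degrees `2n − k` and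
`k`), and `(−1)^{k(2n−k)} = (−1)^k` — the printed «`ε_{K^c,K} = (−1)^k ε_{K,K^c}`».
[cite: Markman2025SecantWeil, proof of Lemma 6.3.1, p. 36 L50–52] -/
theorem swap_sign_compl (n k : ℕ) (hk : k ≤ 2 * n) : (-1 : ℤ) ^ (k * (2 * n - k)) = (-1) ^ k := by
  rcases Nat.even_or_odd k with he | ho
  · rw [he.neg_one_pow, (he.mul_right _).neg_one_pow]
  · have hodd : Odd (k * (2 * n - k)) := by
      apply ho.mul
      obtain ⟨m, rfl⟩ := ho
      exact ⟨n - m - 1, by omega⟩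
    rw [ho.neg_one_pow, hodd.neg_one_pow]

/-- … and the two printed exponents agree: `(Σ(K) − k(k+1)/2) + k = Σ(K) − k(k−1)/2` (with `k(k+1)/2 ≤ Σ(K)`,
`k ≥ 1`; for `k = 0` both sides are `Σ`). [cite: Markman2025SecantWeil, proof of Lemma 6.3.1, p. 36 L50–52] -/
theorem exponent_Kc_K (S k : ℕ) (hS : k * (k + 1) / 2 ≤ S) :
    S - k * (k + 1) / 2 + k = S - k * (k - 1) / 2 := by
  rcases Nat.eq_zero_or_pos k with rfl | hk
  · simp
  · obtain ⟨j, rfl⟩ : ∃ j, k = j + 1 := ⟨k - 1, by omega⟩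
    have h1 : (j + 1) * (j + 1 + 1) / 2 = j * (j + 1) / 2 + (j + 1) := by
      have : (j + 1) * (j + 1 + 1) = j * (j + 1) + 2 * (j + 1) := by ring
      rw [this, Nat.add_mul_div_left _ _ (by norm_num)]
    have h2 : (j + 1) * (j + 1 - 1) / 2 = j * (j + 1) / 2 := by
      rw [Nat.add_sub_cancel, mul_comm]
    rw [h2]; omega

/-- The sign on the other side: `(−1)^k · (−1)^{e} = (−1)^{e + k}` — «`ε_{K^c,K} = (−1)^k ε_{K,K^c}`» combined with §A.
[cite: Markman2025SecantWeil, proof of Lemma 6.3.1, p. 36 L50–52] -/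
theorem sign_Kc_K (S k : ℕ) (hS : k * (k + 1) / 2 ≤ S) :
    (-1 : ℤ) ^ k * (-1) ^ (S - k * (k + 1) / 2) = (-1) ^ (S - k * (k - 1) / 2) := by
  rw [← pow_add, add_comm, exponent_Kc_K S k hS]

/-- «We have `e_K ∧ ε_{K,K^c}e_{K^c} = (ε_{K,K^c})²e_{K∪K^c} = e₁ ∧ ⋯ ∧ e_{2n}`»: `((−1)^m)² = 1`.
[cite: Markman2025SecantWeil, proof of Lemma 6.3.1, p. 36 L52–55] -/
theorem sign_sq (m : ℕ) : ((-1 : ℤ) ^ m) ^ 2 = 1 := by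
  rw [← pow_mul, mul_comm, pow_mul, neg_one_sq, one_pow]

/-! ### §C — footnote 13: `σ_K = (−1)^{k(k+3)/2}` -/

/-- The exponent identity behind `σ_K`: `k(k+3)/2 = k(k+1)/2 + k` (exact integer division).
[cite: Markman2025SecantWeil, footnote 13, p. 37 L75–83] -/
theorem sigma_exponent (k : ℕ) : k * (k + 3) / 2 = k * (k + 1) / 2 + k := by
  have : k * (k + 3) = k * (k + 1) + 2 * k := by ring
  rw [this, Nat.add_mul_div_left _ _ (by norm_num)]

/-- FOOTNOTE 13: «`ϕ_𝒫 = (−1)^{k(k+1)/2+n}PD_k` … the composition … is `(−1)^{k+n}` … `(−1)^{k+n}ϕ_𝒫 = (−1)^{k(k+3)/2}PD_k`»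
— the sign product `(−1)^{k+n}(−1)^{k(k+1)/2+n} = (−1)^{k(k+3)/2}` (the two `n`'s cancel).
[cite: Markman2025SecantWeil, footnote 13, p. 37 L75–83] -/
theorem footnote13 (k n : ℕ) :
    (-1 : ℤ) ^ (k + n) * (-1) ^ (k * (k + 1) / 2 + n) = (-1) ^ (k * (k + 3) / 2) := by
  rw [← pow_add, sigma_exponent]
  have : k + n + (k * (k + 1) / 2 + n) = (k * (k + 1) / 2 + k) + 2 * n := by ring
  rw [this, pow_add, pow_mul, neg_one_sq, one_pow, mul_one]

/-! ### §D — (6.3.1): «`σ_{I′}ε_{I′,(I′)^c} = (−1)^{Σ(I′) − |I′|}`» -/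

/-- (6.3.1)'s second line: with `σ_{I′} = (−1)^{k(k+3)/2}` and `ε_{I′,(I′)^c} = (−1)^{Σ(I′) − k(k+1)/2}` (`k = |I′|`,
`k(k+1)/2 ≤ Σ(I′)` by §A, and `k ≤ Σ(I′)`), the product is `(−1)^{Σ(I′) − |I′|}`
(`k(k+3)/2 + Σ − k(k+1)/2 = Σ + k ≡ Σ − k`). [cite: Markman2025SecantWeil, (6.3.1), p. 37 L15–34] -/
theorem eq631_exponent (S k : ℕ) (hS : k * (k + 1) / 2 ≤ S) (hk : k ≤ S) :
    (-1 : ℤ) ^ (k * (k + 3) / 2) * (-1) ^ (S - k * (k + 1) / 2) = (-1) ^ (S - k) := by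
  rw [← pow_add, sigma_exponent]
  have : k * (k + 1) / 2 + k + (S - k * (k + 1) / 2) = (S - k) + 2 * k := by omega
  rw [this, pow_add, pow_mul, neg_one_sq, one_pow, mul_one]

/-- For a genuine `I′ ⊂ [1, 2n]` both side conditions of `eq631_exponent` hold: `|I′| ≤ Σ(I′)` (all elements `≥ 1`) and
`|I′|(|I′|+1)/2 ≤ Σ(I′)` (§A). [cite: Markman2025SecantWeil, (6.3.1), p. 37 L15–34] -/
theorem card_le_sum (K : Finset ℕ) (hK : ∀ a ∈ K, 1 ≤ a) :
    K.card ≤ ∑ a ∈ K, a ∧ K.card * (K.card + 1) / 2 ≤ ∑ a ∈ K, a := by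
  refine ⟨?_, (inversions_eq_printed K hK).2⟩
  calc K.card = ∑ a ∈ K, 1 := by simp
    _ ≤ ∑ a ∈ K, a := sum_le_sum hK

/-! ### §E — the `φ̃` side and the comparison (6.3.2) -/

/-- «`(−1)^{|I|(2n−|I′|)}`» (moving `e_I`, degree `|I|`, past `δ_{I′}(f₁ ∧ ⋯ ∧ f_{2n})`, degree `2n − |I′|`) equals
`(−1)^{|I||I′|}` (`|I′| ≤ 2n`; the difference in exponents is `2n|I|`).
[cite: Markman2025SecantWeil, proof of Lemma 6.3.1, p. 37 L52–60] -/
theorem sign_move_past (n i i' : ℕ) (hi' : i' ≤ 2 * n) :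
    (-1 : ℤ) ^ (i * (2 * n - i')) = (-1) ^ (i * i') := by
  have : i * (2 * n - i') + i * i' = 2 * (n * i) := by
    zify [hi']; ring
  have h2 : (-1 : ℤ) ^ (i * (2 * n - i')) * (-1) ^ (i * i') = 1 := by
    rw [← pow_add, this, pow_mul, neg_one_sq, one_pow]
  have h3 : ((-1 : ℤ) ^ (i * i')) * (-1) ^ (i * i') = 1 := by
    rw [← pow_add, ← two_mul, pow_mul, neg_one_sq, one_pow]
  -- both are the inverse of `(−1)^{i i'}`
  have hu : IsUnit ((-1 : ℤ) ^ (i * i')) := (isUnit_one.neg).pow _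
  exact (hu.mul_left_inj).mp (h2.trans h3.symm)

/-- «`ε_{I,I′}(−1)^{|I||I′|} = ε_{I′,I}`» (the fourth → fifth line): from graded commutativity
`e_{I′} ∧ e_I = (−1)^{|I||I′|} e_I ∧ e_{I′}`, i.e. `ε′ = (−1)^{|I||I′|} ε`, one gets `ε · (−1)^{|I||I′|} = ε′`.
[cite: Markman2025SecantWeil, proof of Lemma 6.3.1, p. 37 L56–65] -/
theorem epsilon_swap (ε ε' : ℤ) (m : ℕ) (h : ε' = (-1) ^ m * ε) : ε * (-1) ^ m = ε' := by
  rw [h, mul_comm]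

/-- «where in the fourth equality we used the equality `δ_{I′}(f₁ ∧ ⋯ ∧ f_{2n}) = (−1)^{Σ(I′)−|I′|}f_{(I′)^c}`» — the
exponent: contracting the `f_a`, `a ∈ I′`, out of `f₁ ∧ ⋯ ∧ f_{2n}` one at a time in decreasing order of `a` passes
`a − 1` factors each (the larger indices already removed do not sit in front), and `Σ_{a∈I′}(a − 1) = Σ(I′) − |I′|`
(all `a ≥ 1`). The contraction rule `δ_{e_a}(f₁ ∧ ⋯) = (−1)^{a−1}(⋯)` with `B₀(e_i, f_j) = δ_{ij}` is BY VALUE.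
[cite: Markman2025SecantWeil, proof of Lemma 6.3.1, p. 37 L66–67] -/
theorem contraction_exponent (K : Finset ℕ) (hK : ∀ a ∈ K, 1 ≤ a) :
    ∑ a ∈ K, (a - 1) = (∑ a ∈ K, a) - K.card := by
  have h : ∑ a ∈ K, (a - 1) + K.card = ∑ a ∈ K, a := by
    rw [card_eq_sum_ones, ← sum_add_distrib]
    exact sum_congr rfl fun a ha => Nat.sub_add_cancel (hK a ha)
  omega

/-- «Comparing with (6.3.1) we get (6.3.2) `ν(π₁^*(e_K) ∧ π₂^*τ(e_L)) = φ̃(e_K ⊗ e_L)`» — term by term: the (6.3.1)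
coefficient `ε_{I′,I}ε_{I,L}(−1)^{Σ(I′)−|I′|}`, multiplied by `τ`'s sign `(−1)^{ℓ(ℓ−1)/2}` on `e_L` ((1.2.3)), is the
last `φ̃` coefficient `ε_{I′,I}(−1)^{ℓ(ℓ−1)/2}(−1)^{Σ(I′)−|I′|}ε_{I,L}` (commutativity of the integer factors).
[cite: Markman2025SecantWeil, (6.3.1)–(6.3.2), p. 37 L15–34 and L61–72] -/
theorem compare_632 (εI'I εIL : ℤ) (sI' tL : ℕ) :
    (εI'I * εIL * (-1) ^ sI') * (-1) ^ tL = εI'I * (-1) ^ tL * (-1) ^ sI' * εIL := by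
  ring

end Literature.AlgebraicGeometry.Markman2025.Lemma631
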